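import Summits.BirchSwinnertonDyer.Rank1Residual.Additive.SubGordHigherOrdinary
import Summits.BirchSwinnertonDyer.Rank1Residual.Additive.QuadraticTwistTypeGOrd
import Summits.BirchSwinnertonDyer.Rank1Residual.AdditivePotMult.Twist
import Literature.NumberTheory.EllipticCurves.SupersingularIrreducibleProofs
import Literature.NumberTheory.EllipticCurves.SerreOpenImageOrdinaryInertiaProofs
import Literature.NumberTheory.EllipticCurves.GlobalMinimalModelProofs
import Literature.NumberTheory.EllipticCurves.SelmerCorankControlRatProofs
import HarnessLib

/-!
# X3♯(G-ord): the Eisenstein case needs NO ordinarity datum — `ClassX3 ∧ SubGord ⊆ ClassX3Gord` at `p ≥ 5`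

HONEST FRAMING (cell `b2b-bsdres`, run/shared/lean/b2b/bsd-rank1-residual/, verbatim in every
file): the goal of the cell is to DELETE the COMBINATION-SHAPED residual classes of the
Birch–Swinnerton-Dyer formula for ALL analytic-rank `≤ 1` elliptic curves over `ℚ` — "full BSD
formula for every rank `≤ 1` curve in class `C`" assembled STRICTLY from published theorems — so
that the rank-`≤ 1` remainder becomes exactly the CONSTRUCTION-SHAPED classes, which are TYPED
(missing-input `Prop`s), NOT attempted. This is not "finishing BSD". Sub-cell `additive-p2`
(X3/X4 at an additive prime, potentially good ORDINARY half): research route; no claim beyond the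
stated classes; theorems only, no named fact; no label moves.

Completes the theory/data dictionary of X3♯(G-ord) (hyp seat, SHARPENED-CONJECTURES §3: "with a
rational `p`-isogeny the reduction over that field is then ORDINARY (census: 334 ‖ 191 X3 pairs,
supersingular 0 ‖ 0)"; "`e ∣ p−1 ⟺` pot-ordinary on 746/746 X3 tame pot-good pairs, NOT on X4").
For the defect-2 cell (Kodaira `I₀*`, `e = 2`, `ord_p Δ_min ≡ 6 (mod 12)`) the twist `E^{(p*)}` has
GOOD reduction at `p` (`12 ∣ ord_p Δ(E^{(p*)}) = 6 + ord_p Δ_min`, `ord_p j ≥ 0`: the valuation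
criterion of `CyclotomicGoodReduction.lean` over `ℚ`, Silverman *AEC* VII.5.1), and when `E[p]` is
REDUCIBLE (class X3) that good reduction is ORDINARY: a good SUPERSINGULAR twist would have
irreducible `E^{(p*)}[p] ≅ E[p] ⊗ χ_{p*}` (Serre 1972 §1.11 Prop. 12, tree theorem
`hasIrreducibleModPGaloisRep_of_dvd_frobeniusTrace`; `irr_iff_of_model_twist`). Hence, at `p ≥ 5`:

* `semistabilityIndex_eq_two_iff` — `e = 2 ⟺ ord_p Δ_min ≡ 6 (mod 12)`;
* `hasGoodReductionAtPrime_twist_pStar` — `ord_p j ≥ 0`, `ord_p Δ_min ≡ 6 (mod 12)`: every globally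
  minimal model of `E^{(p*)}` has good reduction at `p` (the census's "N′ = N/p²", 681/681);
* `goodOrd_twist_of_red` — `E[p]` reducible + the twist good at `p` ⇒ the twist is good ORDINARY;
* **`classX3Gord_of_subGordTwo`**, **`classX3Gord_of_subGord`** — `ClassX3 W p → SubGord W p →
  ClassX3Gord W p` (`p ≥ 5`; with gen 3's `classX3Gord_of_subGordHigher` for `e ≠ 2` and gen 0's
  `classX3Gord_of_goodOrd_quadraticTwist` for `e = 2`): additive-p4's DATA cell (G-ord) restricted to
  X3 lies in the THEORY class X3♯(G-ord) of `PotGoodOrdinary.lean` with no further input. (For X4 the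
  `e = 2` cell does contain potentially good SUPERSINGULAR pairs — 163 ‖ 46 in the census — so the
  twist's ordinarity stays a genuine datum there: `classX4Gord_of_goodOrd_quadraticTwist`.) At
  `p = 3` (270 of the 334 pairs, all `e = 2`) the valuation criterion over `ℚ` is not available in
  this form and the twist datum of gen 0 remains the route.

References: J.-P. Serre, Invent. Math. 15 (1972) §1.11 Prop. 12; J. H. Silverman, *AEC* VII.5.1,
X.5 Cor. 5.4, *ATAEC* IV §9 Table 4.1; D. Delbourgo, Compositio Math. 113 (1998) §1.5;
A. Néron, Publ. IHÉS 21 (1964) (global minimal models over `ℚ`).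
-/

noncomputable section

open scoped Classical NumberField

open WeierstrassCurve IsDedekindDomain IsDedekindDomain.HeightOneSpectrum NumberField
  Literature.NumberTheory.EllipticCurves Literature.NumberTheory.EllipticCurves.Rank1Residual
  Summit.BirchSwinnertonDyer.Rank1Residual.AdditivePotMult

namespace Summit.BirchSwinnertonDyer.Rank1Residual.Additive

variable (W : WeierstrassCurve ℚ) [W.IsElliptic] [W.IsGloballyMinimal] (p : ℕ) [hp : Fact p.Prime]

/-! ### `e = 2 ⟺ ord_p Δ_min ≡ 6 (mod 12)` -/

omit [W.IsElliptic] hp in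
/-- The census's semistability index is `2` (Kodaira `I₀*`) iff `ord_p Δ_min ≡ 6 (mod 12)`
(`e = 12 / gcd(12, v)` and `gcd(12, v) = 6 ⟺ v ≡ 6 (mod 12)`). -/
theorem semistabilityIndex_eq_two_iff :
    semistabilityIndex W p = 2 ↔ padicValInt p W.minimalDiscriminantInt % 12 = 6 := by
  set v := padicValInt p W.minimalDiscriminantInt with hv
  have hg : Nat.gcd 12 v = Nat.gcd (v % 12) 12 := Nat.gcd_rec 12 v
  show 12 / Nat.gcd 12 v = 2 ↔ v % 12 = 6
  rw [hg]
  have hlt : v % 12 < 12 := Nat.mod_lt v (by norm_num)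
  generalize v % 12 = k at hlt ⊢
  interval_cases k <;> simp

/-! ### The twist by `p*` has good reduction at `p` when `e = 2` -/

/-- **The twist `E^{(p*)}` has good reduction at `p` on the defect-2 cell** (`p ≥ 5`): if
`ord_p j(E) ≥ 0` and `ord_p Δ_min(E) ≡ 6 (mod 12)`, then every globally minimal model `Wd` of
`E^{(p*)}` (`p* = (−1)^{⌊p/2⌋} p`) satisfies `Wd.HasGoodReductionAtPrime p`: on the twisted model
`Δ(E^{(p*)}) = (p*)⁶ Δ(E)` has `ord_p = 6 + ord_p Δ_min ∈ 12ℤ` and `j` is unchanged, so the valuation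
criterion (`hasGoodReductionAt_of_valuation_j_le_one_of_valuation_pow_twelve`, Silverman *AEC*
VII.5.1) gives good reduction at the place over `p`, a property of the curve
(`hasGoodReductionAt_smul_iff_holds`, `hasGoodReductionAtPrime_of_hasGoodReductionAt`). -/
theorem hasGoodReductionAtPrime_twist_pStar (hp5 : 5 ≤ p) (hj : 0 ≤ padicValRat p W.j)
    (hv : padicValInt p W.minimalDiscriminantInt % 12 = 6) (Wd : WeierstrassCurve ℚ)
    [Wd.IsElliptic] [Wd.IsGloballyMinimal] (C : VariableChange ℚ)
    (hWd : C • W.quadraticTwist ((-1 : ℚ) ^ (p / 2) * p) = Wd) : Wd.HasGoodReductionAtPrime p := by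
  set d : ℚ := (-1 : ℚ) ^ (p / 2) * p with hddef
  have hp0 : (p : ℚ) ≠ 0 := by exact_mod_cast hp.out.ne_zero
  have hd0 : d ≠ 0 := mul_ne_zero (pow_ne_zero _ (by norm_num)) hp0
  haveI : NeZero (2 : ℚ) := ⟨two_ne_zero⟩
  haveI hVell : (W.quadraticTwist d).IsElliptic := W.isElliptic_quadraticTwist hd0
  -- the place of `𝓞 ℚ` above `p`
  set u : HeightOneSpectrum (𝓞 ℚ) := (Rat.HeightOneSpectrum.primesEquiv (R := 𝓞 ℚ)).symm ⟨p, hp.out⟩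
    with hudef
  have hpu : (p : 𝓞 ℚ) ∈ u.asIdeal :=
    (natCast_mem_asIdeal_iff_eq_primesEquiv_symm u hp.out).mpr rfl
  have hnotMem : ∀ q : ℕ, (hq : q.Prime) → q ≠ p → (q : 𝓞 ℚ) ∉ u.asIdeal := by
    intro q hq hqp hmem
    have h := (natCast_mem_asIdeal_iff_eq_primesEquiv_symm u hq).mp hmem
    rw [hudef] at h
    exact hqp (congrArg Subtype.val
      ((Rat.HeightOneSpectrum.primesEquiv (R := 𝓞 ℚ)).symm.injective h)).symm
  have h2 : (2 : 𝓞 ℚ) ∉ u.asIdeal := by simpa using hnotMem 2 Nat.prime_two (by omega)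
  have h3 : (3 : 𝓞 ℚ) ∉ u.asIdeal := by simpa using hnotMem 3 Nat.prime_three (by omega)
  -- valuations at `u` are `p`-adic
  haveI : Fact (Nat.Prime ((Rat.HeightOneSpectrum.primesEquiv u : Nat.Primes) : ℕ)) :=
    ⟨(Rat.HeightOneSpectrum.primesEquiv u).2⟩
  have hequiv := Rat.HeightOneSpectrum.valuation_equiv_padicValuation u
  have hq : ((Rat.HeightOneSpectrum.primesEquiv u : Nat.Primes) : ℕ) = p := by
    rw [hudef, Equiv.apply_symm_apply]
  -- `u(j) ≤ 1` for the twist (`j(E^{(d)}) = j(E)`)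
  have hjV : (W.quadraticTwist d).j = W.j := W.j_quadraticTwist hd0
  have hj1 : u.valuation ℚ (W.quadraticTwist d).j ≤ 1 := by
    rw [hjV, Valuation.isEquiv_iff_val_le_one.mp hequiv]
    by_cases hj0 : W.j = 0
    · rw [hj0, map_zero]; exact zero_le
    rw [padicValuation_apply_of_ne_zero _ hj0, ← WithZero.exp_zero, WithZero.exp_le_exp, hq]
    linarith
  -- `ord_p Δ(E^{(d)}) = 6 + ord_p Δ_min = 12 (m + 1)`
  set v := padicValInt p W.minimalDiscriminantInt with hvdef
  obtain ⟨m, hm⟩ : ∃ m, v = 12 * m + 6 := ⟨v / 12, by omega⟩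
  have hΔ0 : W.Δ ≠ 0 := W.isUnit_Δ.ne_zero
  have hΔV : (W.quadraticTwist d).Δ = d ^ 6 * W.Δ := W.quadraticTwist_Δ d
  have hΔV0 : (W.quadraticTwist d).Δ ≠ 0 := by rw [hΔV]; exact mul_ne_zero (pow_ne_zero _ hd0) hΔ0
  have hvd : padicValRat p d = 1 := by
    rw [hddef, padicValRat.mul (pow_ne_zero _ (by norm_num)) hp0, padicValRat.pow,
      padicValRat.self hp.out.one_lt, padicValRat.neg, padicValRat.one, mul_zero, zero_add]
  have hvΔV : padicValRat p (W.quadraticTwist d).Δ = 12 * (m + 1 : ℕ) := by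
    rw [hΔV, padicValRat.mul (pow_ne_zero _ hd0) hΔ0, padicValRat.pow, hvd, padicValRat_Δ_eq W p,
      ← hvdef, hm]
    push_cast; ring
  have hδ : u.valuation ℚ ((p : ℚ) ^ (m + 1)) ^ 12 = u.valuation ℚ (W.quadraticTwist d).Δ := by
    rw [← map_pow, hequiv.eq_iff, ← pow_mul, padicValuation_apply_of_ne_zero _ (pow_ne_zero _ hp0),
      padicValuation_apply_of_ne_zero _ hΔV0, WithZero.exp_inj, hq, padicValRat.pow,
      padicValRat.self hp.out.one_lt, hvΔV]
    push_cast; ring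
  have hgoodV : (W.quadraticTwist d).HasGoodReductionAt u :=
    hasGoodReductionAt_of_valuation_j_le_one_of_valuation_pow_twelve (W.quadraticTwist d) h2 h3 hj1 hδ
  have hgoodWd : Wd.HasGoodReductionAt u := by
    rw [← hWd]
    exact (hasGoodReductionAt_smul_iff_holds u (W.quadraticTwist d) C).mpr hgoodV
  exact hasGoodReductionAtPrime_of_hasGoodReductionAt Wd u hpu hgoodWd

/-! ### Reducible `E[p]` + good twist ⇒ good ORDINARY twist -/

omit [W.IsGloballyMinimal] in
/-- **An Eisenstein prime stays non-supersingular under twisting**: if `E[p]` is reducible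
(`Red W p`, `p ≠ 2`) and a globally minimal model `Wd` of a quadratic twist `E^{(d)}` has good
reduction at `p`, then `Wd` is good ORDINARY at `p` (`GoodOrd Wd p`) — a good supersingular `Wd`
would have irreducible `E^{(d)}[p]` (Serre 1972 §1.11 Prop. 12, tree
`hasIrreducibleModPGaloisRep_of_dvd_frobeniusTrace`), but `E^{(d)}[p] ≅ E[p] ⊗ χ_d` is reducible
with `E[p]` (`irr_iff_of_model_twist`, Silverman *AEC* X.5.4). [cite: Serre1972, §1.11 Prop. 12] -/
theorem goodOrd_twist_of_red (hp2 : p ≠ 2) (hred : Red W p) {d : ℚ} (hd : d ≠ 0)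
    (Wd : WeierstrassCurve ℚ) [Wd.IsElliptic] [Wd.IsGloballyMinimal]
    (hWd : ∃ C : VariableChange ℚ, C • W.quadraticTwist d = Wd)
    (hgood : Wd.HasGoodReductionAtPrime p) : GoodOrd Wd p := by
  refine ⟨hgood, fun hss ↦ hred ?_⟩
  have hirr : Irr Wd p :=
    hasIrreducibleModPGaloisRep_of_dvd_frobeniusTrace Wd p hp2
      (Wd.not_dvd_minimalDiscriminantInt_of_hasGoodReductionAtPrime' p hgood) hss
  exact (irr_iff_of_model_twist hd hWd).mp hirr

/-! ### `ClassX3 ∧ SubGord ⊆ ClassX3Gord` -/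

/-- **X3 ∩ (G-ord census cell, `e = 2`) ⊆ X3♯(G-ord)** (`p ≥ 5`), with NO datum on the twist: for
an Eisenstein additive prime in additive-p4's data cell `SubGordTwo` (`¬(ord_p j < 0)`, `f_p = 2`,
`e = 2`), a globally minimal model of `E^{(p*)}` (Néron, `hasGlobalMinimalModel_rat_holds`) is good
at `p` (`hasGoodReductionAtPrime_twist_pStar`) and ordinary (`goodOrd_twist_of_red`), so gen 0's
`classX3Gord_of_goodOrd_quadraticTwist` applies. [cite: Serre1972, §1.11 Prop. 12] -/
theorem classX3Gord_of_subGordTwo (hp5 : 5 ≤ p) (hX : ClassX3 W p) (hS : SubGordTwo W p) :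
    ClassX3Gord W p := by
  obtain ⟨⟨hnot, -, -⟩, he⟩ := hS
  have hj : 0 ≤ padicValRat p W.j := not_lt.mp hnot
  have hv : padicValInt p W.minimalDiscriminantInt % 12 = 6 :=
    (semistabilityIndex_eq_two_iff W p).mp he
  have hp2 : p ≠ 2 := by omega
  set d : ℚ := (-1 : ℚ) ^ (p / 2) * p with hddef
  have hd0 : d ≠ 0 :=
    mul_ne_zero (pow_ne_zero _ (by norm_num)) (by exact_mod_cast hp.out.ne_zero)
  haveI : NeZero (2 : ℚ) := ⟨two_ne_zero⟩
  haveI : (W.quadraticTwist d).IsElliptic := W.isElliptic_quadraticTwist hd0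
  obtain ⟨C, hC⟩ := hasGlobalMinimalModel_rat_holds (W.quadraticTwist d)
  haveI := hC
  have hgood : (C • W.quadraticTwist d).HasGoodReductionAtPrime p :=
    hasGoodReductionAtPrime_twist_pStar W p hp5 hj hv (C • W.quadraticTwist d) C rfl
  have hord : GoodOrd (C • W.quadraticTwist d) p :=
    goodOrd_twist_of_red W p hp2 hX.1 hd0 (C • W.quadraticTwist d) ⟨C, rfl⟩ hgood
  exact classX3Gord_of_goodOrd_quadraticTwist W p hp2 hX (C • W.quadraticTwist d) C rfl hord

/-- **X3 ∩ (G-ord census cell) ⊆ X3♯(G-ord)** (`p ≥ 5`): `ClassX3 W p → SubGord W p →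
ClassX3Gord W p` — the `e = 2` part by `classX3Gord_of_subGordTwo`, the `e ∈ {3,4,6}` part by
`classX3Gord_of_subGordHigher` (`SubGordHigherOrdinary.lean`). The DATA cell (G-ord) of X3 is
Delbourgo's (G) with ORDINARY reduction, in the kernel, with no further input — the census's
"X3♯(G-ord): supersingular 0 ‖ 0" as a theorem. [cite: Serre1972, §1.11 Prop. 12] -/
theorem classX3Gord_of_subGord (hp5 : 5 ≤ p) (hX : ClassX3 W p) (hS : SubGord W p) :
    ClassX3Gord W p := by
  by_cases he : semistabilityIndex W p = 2
  · exact classX3Gord_of_subGordTwo W p hp5 hX ⟨hS, he⟩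
  · exact classX3Gord_of_subGordHigher W p hp5 hX ⟨hS, he⟩

/-- In particular an X3 pair in the (G-ord) census cell is of Delbourgo type (G)-ORDINARY
(`TypeGOrd W p`), `p ≥ 5`. -/
theorem typeGOrd_of_classX3_of_subGord (hp5 : 5 ≤ p) (hX : ClassX3 W p) (hS : SubGord W p) :
    TypeGOrd W p :=
  (classX3Gord_of_subGord W p hp5 hX hS).typeGOrd

end Summit.BirchSwinnertonDyer.Rank1Residual.Additive

end
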